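import Summits.CriticalPhenomena.SAWScalingLimit.Theorems.SAWLoopFugacityFlowIsingBoundaryRatioWindowCrossingCells
import HarnessLib

/-!
# Radial crossings pass through the window rectangle — `E`-segments of a crossing and their rim ends
(line `fk-anchor-transfer`, crux `IsingBoundaryRatio`, stmt-CriticalPhenomena-10650; combinatorial helper module of
the proof of `AnnCrossThroughWindowRect`)

`exists_inner_outer_segment`: the walk-combinatorial heart of step (B) of the proof. Data: a graph `H` on the
sites of a finite volume `Λ`, an edge set `E`, a "radius" `rad`, a band `r₁' < r₂'`, and two hypotheses —
(closedness) every `H`-edge at a vertex of `E` of band radius is in `E`; (band crossing) every walk of `H` from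
radius `≤ r₁'` to radius `≥ r₂'` whose darts start at radius `< r₂'` has a vertex of `E` of radius inside the
open band. Conclusion: a walk `x → y → ⋯ → b` with `rad x < r₁'`, first edge off `E`, `rad b ≥ r₂'` and `b` not a
vertex of `E` contains a sub-walk all of whose edges are in `E`, from a vertex of `E` of radius `< r₁'` carrying
an `H`-edge off `E` to a vertex of `E` of radius `> r₂'` carrying an `H`-edge off `E` (the two RIM darts).
Proof: the first ascent of the band lies in `E` (band crossing + closedness in both directions), its maximal
`E`-extension starts at an inner rim vertex; if it ends at an inner rim vertex, induct on the remaining walk.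
-/

noncomputable section

open scoped Classical Topology
open Filter Set Metric SimpleGraph Complex
open Literature.Probability.LatticeModels Literature.Probability.RandomPlanarGeometry
open Literature.Probability.Percolation (BondConfig)
open Literature.Topology.PlaneTopology
open UpperHalfPlane (upperHalfPlaneSet)

namespace Summit.CriticalPhenomena.SAWScalingLimit.Theorems.IsingBoundaryRatio

set_option maxHeartbeats 2000000 in
/-- **Inner-to-outer `E`-segment of a crossing** (see the module docstring). [folklore] -/
theorem exists_inner_outer_segment {Λ : Finset (Site 2)} (H : SimpleGraph Λ) (E : Finset (Sym2 (Site 2)))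
    (rad : Λ → ℝ) {r₁' r₂' : ℝ} (h12 : r₁' < r₂')
    (RC : ∀ x y : Λ, x.1 ∈ DiscreteRect.verts E → r₁' ≤ rad x → rad x ≤ r₂' → H.Adj x y → s(x.1, y.1) ∈ E)
    (bandA : ∀ (p q : Λ) (Z : H.Walk p q), rad p ≤ r₁' → r₂' ≤ rad q → (∀ d ∈ Z.darts, rad d.fst < r₂') →
      ∃ z ∈ Z.support, z.1 ∈ DiscreteRect.verts E ∧ r₁' < rad z ∧ rad z < r₂')
    {b : Λ} (hb : r₂' ≤ rad b) (hbE : b.1 ∉ DiscreteRect.verts E) :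
    ∀ (x y : Λ) (hxy : H.Adj x y) (W' : H.Walk y b), rad x < r₁' → s(x.1, y.1) ∉ E →
      ∃ (u v : Λ) (P : H.Walk u v), u.1 ∈ DiscreteRect.verts E ∧ rad u < r₁' ∧
        (∃ u' : Λ, H.Adj u u' ∧ s(u.1, u'.1) ∉ E) ∧ v.1 ∈ DiscreteRect.verts E ∧ r₂' < rad v ∧
        (∃ v' : Λ, H.Adj v v' ∧ s(v.1, v'.1) ∉ E) ∧
        (∀ e ∈ P.edges, e ∈ (Walk.cons hxy W').edges) ∧ ∀ e ∈ P.edges, Sym2.map Subtype.val e ∈ E := by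
  -- rim dichotomy and propagation of `E`-membership along a walk in the band
  have rim : ∀ x y : Λ, x.1 ∈ DiscreteRect.verts E → H.Adj x y → s(x.1, y.1) ∉ E →
      rad x < r₁' ∨ r₂' < rad x := by
    intro x y hx hxy hE
    by_contra h
    push Not at h
    exact hE (RC x y hx h.1 h.2 hxy)
  have hedge : ∀ d : H.Dart, Sym2.map Subtype.val d.edge = s(d.fst.1, d.snd.1) := fun d => by
    rw [show d.edge = s(d.fst, d.snd) from rfl, Sym2.map_mk]
  have propag : ∀ (p q : Λ) (R : H.Walk p q), p.1 ∈ DiscreteRect.verts E →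
      (∀ d ∈ R.darts, r₁' ≤ rad d.fst ∧ rad d.fst ≤ r₂') → ∀ e ∈ R.edges, Sym2.map Subtype.val e ∈ E := by
    intro p q R
    induction R with
    | nil => intro _ _ e he; simp at he
    | @cons a' b' c' hab R' ih =>
      intro ha' hd e he
      have h1 := hd ⟨(a', b'), hab⟩ (by simp)
      have hab' : s(a'.1, b'.1) ∈ E := RC _ _ ha' h1.1 h1.2 hab
      rw [Walk.edges_cons, List.mem_cons] at he
      rcases he with rfl | he
      · rwa [Sym2.map_mk]
      · exact ih (mem_verts_of_mem hab').2 (fun d hd' => hd d (by simp [hd'])) e he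
  -- strong induction on the length of `W'`
  intro x y hxy W'
  induction hL : W'.length using Nat.strong_induction_on generalizing x y W' with
  | _ L ih =>
  intro hxr hxyE
  set W := Walk.cons hxy W' with hW
  -- (1) the first vertex `wt` of radius `≥ r₂'`
  obtain ⟨wt, W₁, W₂, hwt, hW₁d, hW₁₂⟩ := exists_split_first_vertex (fun z : Λ => r₂' ≤ rad z) W hb
  have hW₁e : ∀ e ∈ W₁.edges, e ∈ W.edges := fun e he => by
    rw [← hW₁₂, Walk.edges_append]; exact List.mem_append_left _ he
  have hW₂e : ∀ e ∈ W₂.edges, e ∈ W.edges := fun e he => by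
    rw [← hW₁₂, Walk.edges_append]; exact List.mem_append_right _ he
  -- (2) the last vertex `ws` of `W₁` of radius `≤ r₁'`; the ascent `Z := A₁.reverse : ws → wt`
  obtain ⟨ws, A₁, A₂, hws, hA₁d, hA₁₂⟩ := exists_split_first_vertex (fun z : Λ => rad z ≤ r₁') W₁.reverse hxr.le
  have hW₁eq : A₂.reverse.append A₁.reverse = W₁ := by
    rw [← Walk.reverse_append, hA₁₂, Walk.reverse_reverse]
  set Z := A₁.reverse with hZ
  have hA₂W₁ : ∀ d ∈ A₂.reverse.darts, d ∈ W₁.darts := fun d hd => by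
    rw [← hW₁eq, Walk.darts_append]; exact List.mem_append_left _ hd
  have hZW₁ : ∀ d ∈ Z.darts, d ∈ W₁.darts := fun d hd => by
    rw [← hW₁eq, Walk.darts_append]; exact List.mem_append_right _ hd
  have hZd1 : ∀ d ∈ Z.darts, rad d.fst < r₂' := fun d hd => not_le.1 (hW₁d d (hZW₁ d hd))
  have hZd2 : ∀ d ∈ Z.darts, r₁' < rad d.snd := fun d hd => by
    rw [hZ, Walk.mem_darts_reverse] at hd
    exact not_le.1 (hA₁d _ hd)
  -- (3) a vertex of `E` inside the band on the ascent, (4) hence all its edges are in `E`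
  obtain ⟨z, hzZ, hzE, hz1, hz2⟩ := bandA ws wt Z hws hwt hZd1
  have hZ₂E : ∀ e ∈ (Z.dropUntil z hzZ).edges, Sym2.map Subtype.val e ∈ E := by
    refine propag _ _ _ hzE fun d hd => ?_
    have hdZ : d ∈ Z.darts := Z.darts_dropUntil_subset_darts hzZ hd
    refine ⟨?_, (hZd1 d hdZ).le⟩
    rcases eq_or_exists_dart_snd_of_mem_support _ ((Z.dropUntil z hzZ).dart_fst_mem_support_of_mem_darts hd)
      with h | ⟨d', hd', hd'eq⟩
    · rw [h]; exact hz1.le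
    · rw [← hd'eq]; exact (hZd2 d' (Z.darts_dropUntil_subset_darts hzZ hd')).le
  have hZ₁E : ∀ e ∈ (Z.takeUntil z hzZ).edges, Sym2.map Subtype.val e ∈ E := by
    have key := propag _ _ (Z.takeUntil z hzZ).reverse hzE fun d hd => ?_
    · intro e he
      exact key e (by rw [Walk.edges_reverse, List.mem_reverse]; exact he)
    · rw [Walk.mem_darts_reverse] at hd
      have hdZ : d.symm ∈ Z.darts := Z.darts_takeUntil_subset_darts hzZ hd
      refine ⟨(hZd2 _ hdZ).le, ?_⟩
      have hmem := (Z.takeUntil z hzZ).dart_snd_mem_support_of_mem_darts hd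
      rw [← Walk.map_fst_darts_append, List.mem_append, List.mem_map, List.mem_singleton] at hmem
      rcases hmem with ⟨d', hd', hd'eq⟩ | h
      · show rad d.symm.snd ≤ r₂'
        rw [← hd'eq]; exact (hZd1 d' (Z.darts_takeUntil_subset_darts hzZ hd')).le
      · show rad d.symm.snd ≤ r₂'
        rw [h]; exact hz2.le
  have hZE : ∀ e ∈ Z.edges, Sym2.map Subtype.val e ∈ E := by
    intro e he
    rw [← Z.take_spec hzZ, Walk.edges_append, List.mem_append] at he
    rcases he with he | he
    exacts [hZ₁E e he, hZ₂E e he]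
  have hZlen : 0 < Z.length := by
    rcases Nat.eq_zero_or_pos Z.length with h0 | h0
    · exfalso
      have := Walk.eq_of_length_eq_zero h0
      rw [this] at hws
      linarith
    · exact h0
  -- (5) the first edge `s(x, y)` lies in `A₂.reverse`, so `A₂` has a dart off `E`
  have hxwt : x ≠ wt := fun h => by rw [h] at hxr; linarith
  have hW₁len : 0 < W₁.length := by
    rcases Nat.eq_zero_or_pos W₁.length with h0 | h0
    · exact absurd (Walk.eq_of_length_eq_zero h0) hxwt
    · exact h0
  obtain ⟨W₁', hW₁c, -⟩ := exists_eq_cons_of_append_eq_cons W₁ W₂ hW₁₂ hW₁len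
  have hxyW₁ : s(x, y) ∈ W₁.edges := by rw [hW₁c, Walk.edges_cons]; exact List.mem_cons_self
  have hA₂off : ∃ d ∈ A₂.darts, ¬ Sym2.map Subtype.val d.edge ∈ E := by
    rw [← hW₁eq, Walk.edges_append, List.mem_append] at hxyW₁
    rcases hxyW₁ with h | h
    · rw [Walk.edges_reverse, List.mem_reverse] at h
      obtain ⟨d, hd, hde⟩ := List.mem_map.1 h
      refine ⟨d, hd, ?_⟩
      rw [hde, Sym2.map_mk]
      exact hxyE
    · exact absurd (by simpa [Sym2.map_mk] using hZE _ h) hxyE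
  -- (6) the maximal `E`-extension to the left: the inner rim vertex `u`
  obtain ⟨u, u', B₁, huu', B₂, hB₁E, huu'E, hB₁₂⟩ :=
    exists_split_first_dart (fun d : H.Dart => Sym2.map Subtype.val d.edge ∈ E) A₂ hA₂off
  rw [hedge] at huu'E
  have hB₁A₂ : ∀ d ∈ B₁.darts, d ∈ A₂.darts := fun d hd => by
    rw [← hB₁₂, Walk.darts_append]; exact List.mem_append_left _ hd
  set P₁ : H.Walk u wt := B₁.reverse.append Z with hP₁
  have hP₁E : ∀ e ∈ P₁.edges, Sym2.map Subtype.val e ∈ E := by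
    intro e he
    rw [hP₁, Walk.edges_append, List.mem_append, Walk.edges_reverse, List.mem_reverse] at he
    rcases he with he | he
    · obtain ⟨d, hd, rfl⟩ := List.mem_map.1 he
      exact hB₁E d hd
    · exact hZE e he
  have hP₁W : ∀ e ∈ P₁.edges, e ∈ W.edges := by
    intro e he
    rw [hP₁, Walk.edges_append, List.mem_append, Walk.edges_reverse, List.mem_reverse] at he
    refine hW₁e e ?_
    rw [← hW₁eq, Walk.edges_append, List.mem_append, Walk.edges_reverse, List.mem_reverse]
    rcases he with he | he
    · left
      rw [← hB₁₂, Walk.edges_append]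
      exact List.mem_append_left _ he
    · exact Or.inr he
  have hP₁len : 0 < P₁.length := by rw [hP₁, Walk.length_append]; omega
  have hP₁d1 : ∀ d ∈ P₁.darts, rad d.fst < r₂' := by
    intro d hd
    rw [hP₁, Walk.darts_append, List.mem_append] at hd
    rcases hd with hd | hd
    · refine not_le.1 (hW₁d d (hA₂W₁ d ?_))
      rw [Walk.mem_darts_reverse] at hd ⊢
      exact hB₁A₂ _ hd
    · exact hZd1 d hd
  obtain ⟨d₁, hd₁, hd₁u⟩ := exists_dart_fst_eq P₁ hP₁len
  have huE : u.1 ∈ DiscreteRect.verts E := by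
    have := hP₁E d₁.edge (List.mem_map.2 ⟨d₁, hd₁, rfl⟩)
    rw [hedge, hd₁u] at this
    exact (mem_verts_of_mem this).1
  have hur : rad u < r₁' := by
    rcases rim u u' huE huu' huu'E with h | h
    · exact h
    · exfalso
      have := hP₁d1 d₁ hd₁
      rw [hd₁u] at this
      linarith
  -- (7) the maximal `E`-extension to the right along `W₂`: the rim vertex `v`
  obtain ⟨dt, hdt, hdtw⟩ := exists_dart_snd_eq Z hZlen
  have hwtE : wt.1 ∈ DiscreteRect.verts E := by
    have := hZE dt.edge (List.mem_map.2 ⟨dt, hdt, rfl⟩)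
    rw [hedge, hdtw] at this
    exact (mem_verts_of_mem this).2
  have hW₂len : 0 < W₂.length := by
    rcases Nat.eq_zero_or_pos W₂.length with h0 | h0
    · exfalso
      have := Walk.eq_of_length_eq_zero h0
      rw [this] at hwtE
      exact hbE hwtE
    · exact h0
  obtain ⟨dl, hdl, hdlb⟩ := exists_dart_snd_eq W₂ hW₂len
  have hdlE : ¬ Sym2.map Subtype.val dl.edge ∈ E := fun h => by
    rw [hedge, hdlb] at h
    exact hbE (mem_verts_of_mem h).2
  obtain ⟨v, v', C₁, hvv', C₂, hC₁E, hvv'E, hC₁₂⟩ :=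
    exists_split_first_dart (fun d : H.Dart => Sym2.map Subtype.val d.edge ∈ E) W₂ ⟨dl, hdl, hdlE⟩
  rw [hedge] at hvv'E
  set P : H.Walk u v := P₁.append C₁ with hP
  have hPE : ∀ e ∈ P.edges, Sym2.map Subtype.val e ∈ E := by
    intro e he
    rw [hP, Walk.edges_append, List.mem_append] at he
    rcases he with he | he
    · exact hP₁E e he
    · obtain ⟨d, hd, rfl⟩ := List.mem_map.1 he
      exact hC₁E d hd
  have hC₁W₂ : ∀ e ∈ C₁.edges, e ∈ W₂.edges := fun e he => by
    rw [← hC₁₂, Walk.edges_append]; exact List.mem_append_left _ he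
  have hPW : ∀ e ∈ P.edges, e ∈ W.edges := by
    intro e he
    rw [hP, Walk.edges_append, List.mem_append] at he
    rcases he with he | he
    exacts [hP₁W e he, hW₂e e (hC₁W₂ e he)]
  have hPlen : 0 < P.length := by rw [hP, Walk.length_append]; omega
  obtain ⟨dv, hdv, hdvv⟩ := exists_dart_snd_eq P hPlen
  have hvE : v.1 ∈ DiscreteRect.verts E := by
    have := hPE dv.edge (List.mem_map.2 ⟨dv, hdv, rfl⟩)
    rw [hedge, hdvv] at this
    exact (mem_verts_of_mem this).2
  rcases rim v v' hvE hvv' hvv'E with hvr | hvr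
  · -- the segment ends at an INNER rim vertex: induct on the rest `v → v' → ⋯ → b`
    have hlen' : C₂.length < L := by
      have h1 := congrArg Walk.length hW₁₂
      have h2 := congrArg Walk.length hC₁₂
      rw [Walk.length_append] at h1 h2
      rw [Walk.length_cons] at h1 h2
      omega
    obtain ⟨u₂, v₂, P₂, h1, h2, h3, h4, h5, h6, h7, h8⟩ := ih C₂.length hlen' v v' hvv' C₂ rfl hvr hvv'E
    refine ⟨u₂, v₂, P₂, h1, h2, h3, h4, h5, h6, fun e he => hW₂e e ?_, h8⟩
    rw [← hC₁₂, Walk.edges_append]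
    exact List.mem_append_right _ (h7 e he)
  · exact ⟨u, v, P, huE, hur, ⟨u', huu', huu'E⟩, hvE, hvr, ⟨v', hvv', hvv'E⟩, hPW, hPE⟩

/-- Inner-to-outer `E`-segment of a crossing, closed form (registered sub-goal of stmt-CriticalPhenomena-10650).
[folklore] -/
theorem exists_inner_outer_segment' : ∀ {Λ : Finset (Site 2)} (H : SimpleGraph Λ) (E : Finset (Sym2 (Site 2))) (rad : Λ → ℝ) {r₁' r₂' : ℝ}, r₁' < r₂' → (∀ x y : Λ, x.1 ∈ DiscreteRect.verts E → r₁' ≤ rad x → rad x ≤ r₂' → H.Adj x y → s(x.1, y.1) ∈ E) → (∀ (p q : Λ) (Z : H.Walk p q), rad p ≤ r₁' → r₂' ≤ rad q → (∀ d ∈ Z.darts, rad d.fst < r₂') → ∃ z ∈ Z.support, z.1 ∈ DiscreteRect.verts E ∧ r₁' < rad z ∧ rad z < r₂') → ∀ {b : Λ}, r₂' ≤ rad b → b.1 ∉ DiscreteRect.verts E → ∀ (x y : Λ) (hxy : H.Adj x y) (W' : H.Walk y b), rad x < r₁' → s(x.1, y.1) ∉ E → ∃ (u v : Λ) (P : H.Walk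 u v), u.1 ∈ DiscreteRect.verts E ∧ rad u < r₁' ∧ (∃ u' : Λ, H.Adj u u' ∧ s(u.1, u'.1) ∉ E) ∧ v.1 ∈ DiscreteRect.verts E ∧ r₂' < rad v ∧ (∃ v' : Λ, H.Adj v v' ∧ s(v.1, v'.1) ∉ E) ∧ (∀ e ∈ P.edges, e ∈ (Walk.cons hxy W').edges) ∧ ∀ e ∈ P.edges, Sym2.map Subtype.val e ∈ E :=
  fun H E rad _ _ h12 RC bandA _ hb hbE => exists_inner_outer_segment H E rad h12 RC bandA hb hbE

end Summit.CriticalPhenomena.SAWScalingLimit.Theorems.IsingBoundaryRatio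

end
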